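import Mathlib
import HarnessLib
import Summits.AnomalousDissipation.AnomalousDissipation.Theses.NeutralTaylorWaves
import Literature.Analysis.FunctionSpaces.TorusFluidGlue
import Summits.AnomalousDissipation.AnomalousDissipation.Theorems.NeutralTaylorWavesNonresonantSelectionLinearisedEnergyIneq
import Summits.AnomalousDissipation.AnomalousDissipation.Theorems.NeutralTaylorWavesNonresonantSelectionResidualPerturbation
import Summits.AnomalousDissipation.AnomalousDissipation.Theorems.NeutralTaylorWavesNonresonantSelectionTransferAlgebra
import Summits.AnomalousDissipation.AnomalousDissipation.Theorems.NeutralTaylorWavesNonresonantSelectionBorderedGapStability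
import Summits.AnomalousDissipation.AnomalousDissipation.Theorems.NeutralTaylorWavesNonresonantSelectionKellerAnalysis
import Summits.AnomalousDissipation.AnomalousDissipation.Theorems.NeutralTaylorWavesNonresonantSelectionKellerAlgebra

/-!
# Skeleton (line `birth`, reshaped by the lead) — crux `NeutralTaylorWaves.NonresonantSelection`
(stmt-AnomalousDissipation-16294)

Line `birth` (registrar skeleton `Lines/birth.lean`): GAP ON ONE COHERENT SPINE × KATO-TYPE STABILITY OF
POLYNOMIAL BORDERED BOUNDS. The crux asks, GIVEN the all-orders quasi-steady family
(`TaylorWaveQuasiSteady`), for the route target `NonresonantTaylorWaves`: sup bounds and the bordered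
a-priori estimate with `(C₀, K₀)` uniform in the order `K`. The line makes the uniformity in `K`
automatic: (i) all order-`K` states sit `ν^a`-close (`W^{1,∞} × drift`) to ONE reference family, the
spine, and (ii) the bordered bound holds at the spine with loss `ν^{-K₀}`, `K₀ + 3 ≤ a`; a perturbation
lemma transfers the bound to every order.

Reshape (lead, cycle 1): the registrar's `stub_borderedGapStability` (Kato-type stability, TRUE) is cut
into three registered stubs whose composition `borderedGapStability_of` is proved here —
* `stub_linearisedEnergyIneq` — the energy inequality of the bordered linearised steady operator at a
  smooth divergence-free base `(w, c)`: `ν‖∇v‖₂² ≤ ‖F‖₂‖v‖₂ + 3G‖v‖₂² + |b|·|⟨v, ∂₃w⟩|`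
  (`∫⟪w·∇v,v⟫ = ∫⟪∇r,v⟫ = ∫⟪∂₃v,v⟫ = 0`, `−ν∫⟪Δv,v⟫ = ν‖∇v‖²`, `|∫⟪v·∇w,v⟫| ≤ 3G∫‖v‖²`);
* `stub_residualPerturbation` — the bordered residuals at two `δ`-close bases differ by
  `≤ δ(2‖∇v‖₂ + 2‖v‖₂ + |b|)` in `L²`, and the border pairings by `≤ δ‖v‖₂`;
* `stub_transferAlgebra` — the real-number endgame (`κ = 1/16`, `A = 2`);
and `stub_coherentSpineGap` (the registrar's stub 1, verbatim up to unfolding `BorderedBound`; the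
hardest, open, held by the lead) is unchanged. All stub signatures are spelled out in tree vocabulary
(no skeleton-local definition occurs in a registered signature).

Composition: `NonresonantSelection_proof : NonresonantSelection` uses the four registered stubs BY NAME
(`stub_coherentSpineGap`; `borderedGapStability` from `stub_linearisedEnergyIneq`,
`stub_residualPerturbation`, `stub_transferAlgebra`) and has no `sorry` of its own.
-/

set_option linter.dupNamespace false

noncomputable section

namespace Summit.AnomalousDissipation.AnomalousDissipation.Cruxes.NonresonantSelection.Birth

open MeasureTheory Set Filter Topology Function
open Literature.Analysis.FunctionSpaces
open Summit.AnomalousDissipation.AnomalousDissipation.Theses.NeutralTaylorWaves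

/-! ### Vocabulary of the seam (skeleton-local; never inside a registered signature) -/

/-- `BorderedBound ν w c M`: the bordered a-priori estimate for the steady Navier–Stokes operator
linearised at `w` with drift `c` along `x₃`, viscosity `ν`, bordered by `⟨v, ∂₃w⟩` and the drift unknown
`b`: `‖v‖₂² + b² ≤ M² (‖w·∇v + v·∇w − νΔv + ∇r − c∂₃v − b∂₃w‖₂² + ⟨v, ∂₃w⟩²)` for all smooth
divergence-free mean-zero `v`, smooth `r`, real `b` — with `M = C₀ ν⁻¹^K₀` the last clause of the route
target verbatim. -/
def BorderedBound (ν : ℝ) (w : UnitAddTorus (Fin 3) → EuclideanSpace ℝ (Fin 3)) (c M : ℝ) : Prop :=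
  ∀ (v : UnitAddTorus (Fin 3) → EuclideanSpace ℝ (Fin 3)) (r : UnitAddTorus (Fin 3) → ℝ) (b : ℝ),
    Torus.IsSmooth v → Torus.IsSmooth r → Torus.IsDivFree v → Torus.HasZeroMean v →
    (∫ x, ‖v x‖ ^ 2) + b ^ 2 ≤
      M ^ 2 * ((∫ x, ‖Torus.convect w v x + Torus.convect v w x - ν • Torus.laplacian v x +
          Torus.gradient r x - c • Torus.partialDeriv (2 : Fin 3) v x -
          b • Torus.partialDeriv (2 : Fin 3) w x‖ ^ 2) +
        (∫ x, inner ℝ (v x) (Torus.partialDeriv (2 : Fin 3) w x)) ^ 2)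

/-- Monotonicity of the bordered bound in the constant. -/
theorem BorderedBound.mono {ν : ℝ} {w : UnitAddTorus (Fin 3) → EuclideanSpace ℝ (Fin 3)} {c M M' : ℝ}
    (h : BorderedBound ν w c M) (hM : M ^ 2 ≤ M' ^ 2) : BorderedBound ν w c M' := by
  intro v r b hv hr hdiv hmean
  refine (h v r b hv hr hdiv hmean).trans ?_
  refine mul_le_mul_of_nonneg_right hM (add_nonneg ?_ (sq_nonneg _))
  exact integral_nonneg fun x => by positivity

/-! ### Registered stubs (signatures in tree vocabulary) -/

/-- STUB 1′ — THE SPECTRAL CORE ON ONE COHERENT SPINE (hardest; open; held by the lead; cycle-2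
reshape of the registrar's `stub_coherentSpineGap`, which is now the theorem `coherentSpineGap_of_core`
below). IF `TaylorWaveQuasiSteady`, THEN there are one smooth divergence-free mean-zero force `f`,
`ν_n → 0⁺`, `E`, `ε₀ > 0`, constants `C₀ ≥ 1`, `K₀`, `3K₀ + 3 ≤ a`, a smooth divergence-free SPINE
`(w₁ n, c₁ n)` and, for infinitely many `n` (with `ν_n ≤ 1`), KELLER DATA at the spine with
`Λ_n = C₀ν_n^{-K₀}`: an adjoint test field `ψ` (`‖ψ‖₂ ≤ 1`) and a pressure `q₃` such that
(Φ) `Λ_n⁻¹ ≤ ‖∂₃w₁‖₂ ≤ Λ_n`, (pairing) `|⟨ψ, ∂₃w₁⟩| ≥ Λ_n⁻¹`, (approximate kernel)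
`‖A₁(∂₃w₁, q₃)‖₂ ≤ Λ_n⁻³`, (approximate cokernel) `2|⟨ψ, A₁(v, r)⟩| ≤ Λ_n⁻³‖v‖₂` on the test class,
(reduced gap) `‖u‖₂ ≤ Λ_n‖A₁(u, r)‖₂` for test fields `u ⊥ ∂₃w₁` — where
`A₁(v, r) = w₁·∇v + v·∇w₁ − ν_nΔv + ∇r − c₁∂₃v` is the UNBORDERED linearised operator; and for every
order `K` a constant `C_K` with, for EVERY `n`, an order-`K` quasi-steady state `(w, q, c)` for the SAME
`f` with the target's sup bounds, `ν_n^a`-close to the spine in `W^{1,∞} × drift`. (For the intended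
family: `f` is `x₃`-invariant, so `∂₃w₁` is an all-orders approximate kernel vector by the translation
identity `L(∂₃w, ∂₃q) = ∂₃R` (`Negative/TranslationMode`); `ψ` is the adjoint cell mode; the reduced gap
and the pairing `⟨∂₃w₁, ψ⟩ ≠ 0` are the crux's open content — cards galilean-bordering-cell-pairing,
kolmogorov-cell-wave-operator.) -/
theorem stub_spineCore :
    TaylorWaveQuasiSteady →
    ∃ f : UnitAddTorus (Fin 3) → EuclideanSpace ℝ (Fin 3),
      Torus.IsSmooth f ∧ Torus.IsDivFree f ∧ Torus.HasZeroMean f ∧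
    ∃ (ν : ℕ → ℝ) (E ε₀ C₀ : ℝ) (K₀ a : ℕ)
      (w₁ : ℕ → UnitAddTorus (Fin 3) → EuclideanSpace ℝ (Fin 3)) (c₁ : ℕ → ℝ),
      (∀ n, 0 < ν n) ∧ Tendsto ν atTop (𝓝 0) ∧ 0 < ε₀ ∧ 1 ≤ C₀ ∧ 3 * K₀ + 3 ≤ a ∧
      (∀ n, Torus.IsSmooth (w₁ n) ∧ Torus.IsDivFree (w₁ n)) ∧
      (∀ N : ℕ, ∃ n : ℕ, N ≤ n ∧ ν n ≤ 1 ∧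
        ∃ (ψ : UnitAddTorus (Fin 3) → EuclideanSpace ℝ (Fin 3)) (q₃ : UnitAddTorus (Fin 3) → ℝ),
          Torus.IsSmooth ψ ∧ Torus.IsSmooth q₃ ∧ (∫ x, ‖ψ x‖ ^ 2) ≤ 1 ∧
          Real.sqrt (∫ x, ‖Torus.partialDeriv (2 : Fin 3) (w₁ n) x‖ ^ 2) ≤ C₀ * (ν n)⁻¹ ^ K₀ ∧
          1 ≤ C₀ * (ν n)⁻¹ ^ K₀ * Real.sqrt (∫ x, ‖Torus.partialDeriv (2 : Fin 3) (w₁ n) x‖ ^ 2) ∧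
          1 ≤ C₀ * (ν n)⁻¹ ^ K₀ * |∫ x, inner ℝ (ψ x) (Torus.partialDeriv (2 : Fin 3) (w₁ n) x)| ∧
          Real.sqrt (∫ x, ‖Torus.convect (w₁ n) (Torus.partialDeriv (2 : Fin 3) (w₁ n)) x +
              Torus.convect (Torus.partialDeriv (2 : Fin 3) (w₁ n)) (w₁ n) x -
              (ν n) • Torus.laplacian (Torus.partialDeriv (2 : Fin 3) (w₁ n)) x + Torus.gradient q₃ x -
              (c₁ n) • Torus.partialDeriv (2 : Fin 3) (Torus.partialDeriv (2 : Fin 3) (w₁ n)) x‖ ^ 2) ≤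
            (C₀ * (ν n)⁻¹ ^ K₀)⁻¹ ^ 3 ∧
          (∀ (v : UnitAddTorus (Fin 3) → EuclideanSpace ℝ (Fin 3)) (r : UnitAddTorus (Fin 3) → ℝ),
            Torus.IsSmooth v → Torus.IsSmooth r → Torus.IsDivFree v → Torus.HasZeroMean v →
            2 * |∫ x, inner ℝ (ψ x) (Torus.convect (w₁ n) v x + Torus.convect v (w₁ n) x -
                (ν n) • Torus.laplacian v x + Torus.gradient r x -
                (c₁ n) • Torus.partialDeriv (2 : Fin 3) v x)| ≤
              (C₀ * (ν n)⁻¹ ^ K₀)⁻¹ ^ 3 * Real.sqrt (∫ x, ‖v x‖ ^ 2)) ∧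
          (∀ (u : UnitAddTorus (Fin 3) → EuclideanSpace ℝ (Fin 3)) (r : UnitAddTorus (Fin 3) → ℝ),
            Torus.IsSmooth u → Torus.IsSmooth r → Torus.IsDivFree u → Torus.HasZeroMean u →
            (∫ x, inner ℝ (u x) (Torus.partialDeriv (2 : Fin 3) (w₁ n) x)) = 0 →
            Real.sqrt (∫ x, ‖u x‖ ^ 2) ≤
              C₀ * (ν n)⁻¹ ^ K₀ * Real.sqrt (∫ x, ‖Torus.convect (w₁ n) u x + Torus.convect u (w₁ n) x -
                (ν n) • Torus.laplacian u x + Torus.gradient r x -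
                (c₁ n) • Torus.partialDeriv (2 : Fin 3) u x‖ ^ 2))) ∧
      ∀ K : ℕ, ∃ C : ℝ, ∀ n : ℕ,
        ∃ (w : UnitAddTorus (Fin 3) → EuclideanSpace ℝ (Fin 3)) (q : UnitAddTorus (Fin 3) → ℝ) (c : ℝ),
          Torus.IsSmooth w ∧ Torus.IsSmooth q ∧ Torus.IsDivFree w ∧ Torus.HasZeroMean w ∧ |c| ≤ C ∧
          (∫ x, ‖w x‖ ^ 2) ≤ E ∧
          |ν n * Torus.gradNormSq w - ε₀| ≤ C * Real.sqrt (ν n) ∧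
          (∫ x, ‖Torus.convect w w x - (ν n) • Torus.laplacian w x + Torus.gradient q x -
              c • Torus.partialDeriv (2 : Fin 3) w x - f x‖ ^ 2) ≤ C * (ν n) ^ K ∧
          (∀ x, ‖w x‖ ≤ C) ∧ (∀ (i : Fin 3) x, ‖Torus.partialDeriv i w x‖ ≤ C * (ν n)⁻¹) ∧
          (∀ (i j : Fin 3) x, ‖Torus.partialDeriv i (Torus.partialDeriv j w) x‖ ≤ C * (ν n)⁻¹ ^ 2) ∧
          (∀ x, ‖w x - w₁ n x‖ ≤ C * (ν n) ^ a) ∧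
          (∀ (i : Fin 3) x, ‖Torus.partialDeriv i w x - Torus.partialDeriv i (w₁ n) x‖ ≤ C * (ν n) ^ a) ∧
          |c - c₁ n| ≤ C * (ν n) ^ a := by
  sorry

/-- STUB 1b — KELLER BORDERING, ANALYTIC HALF (LANDED p160794,
`Theorems.NeutralTaylorWavesNonresonantSelectionKellerAnalysis`). At a smooth divergence-free base
`w` with drift `c`, viscosity `ν`, let `A(v, r) = w·∇v + v·∇w − νΔv + ∇r − c∂₃v` and let `(v, r, b)` be a
test triple with bordered residual `F = A(v, r) − b∂₃w`. Put `Φ² = ‖∂₃w‖₂² > 0`,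
`s = ⟨v, ∂₃w⟩/Φ²` and `u = v − s∂₃w` (smooth, divergence-free, mean-zero, `⊥ ∂₃w`). Then
(i) `‖v‖₂ ≤ ‖u‖₂ + |s|Φ` (Minkowski); (ii) if `A` has the reduced bound `‖u′‖₂ ≤ Λ‖A(u′, r′)‖₂` on test
fields `u′ ⊥ ∂₃w` (`Λ ≥ 0`) and `‖A(∂₃w, q₃)‖₂ ≤ ρ`, then `‖u‖₂ ≤ Λ(‖F‖₂ + |b|Φ + |s|ρ)` (linearity:
`A(u, r − s q₃) = F + b∂₃w − sA(∂₃w, q₃)`); (iii) if `|⟨ψ, A(v′, r′)⟩| ≤ ρ′‖v′‖₂` on the test class and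
`‖ψ‖₂ ≤ 1`, then `|b|·|⟨ψ, ∂₃w⟩| ≤ ‖F‖₂ + ρ′‖v‖₂` (pair `F` with `ψ`, Cauchy–Schwarz). -/
theorem stub_kellerAnalysis :
    ∀ (ν c b Λ ρ ρ' : ℝ) (w ψ v : UnitAddTorus (Fin 3) → EuclideanSpace ℝ (Fin 3))
      (q₃ r : UnitAddTorus (Fin 3) → ℝ),
      0 ≤ Λ → Torus.IsSmooth w → Torus.IsDivFree w → Torus.IsSmooth ψ → Torus.IsSmooth q₃ →
      Torus.IsSmooth v → Torus.IsDivFree v → Torus.HasZeroMean v → Torus.IsSmooth r →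
      0 < (∫ x, ‖Torus.partialDeriv (2 : Fin 3) w x‖ ^ 2) →
      (∫ x, ‖ψ x‖ ^ 2) ≤ 1 →
      (∀ (u : UnitAddTorus (Fin 3) → EuclideanSpace ℝ (Fin 3)) (r' : UnitAddTorus (Fin 3) → ℝ),
        Torus.IsSmooth u → Torus.IsSmooth r' → Torus.IsDivFree u → Torus.HasZeroMean u →
        (∫ x, inner ℝ (u x) (Torus.partialDeriv (2 : Fin 3) w x)) = 0 →
        Real.sqrt (∫ x, ‖u x‖ ^ 2) ≤
          Λ * Real.sqrt (∫ x, ‖Torus.convect w u x + Torus.convect u w x - ν • Torus.laplacian u x +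
            Torus.gradient r' x - c • Torus.partialDeriv (2 : Fin 3) u x‖ ^ 2)) →
      Real.sqrt (∫ x, ‖Torus.convect w (Torus.partialDeriv (2 : Fin 3) w) x +
          Torus.convect (Torus.partialDeriv (2 : Fin 3) w) w x -
          ν • Torus.laplacian (Torus.partialDeriv (2 : Fin 3) w) x + Torus.gradient q₃ x -
          c • Torus.partialDeriv (2 : Fin 3) (Torus.partialDeriv (2 : Fin 3) w) x‖ ^ 2) ≤ ρ →
      (∀ (v' : UnitAddTorus (Fin 3) → EuclideanSpace ℝ (Fin 3)) (r' : UnitAddTorus (Fin 3) → ℝ),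
        Torus.IsSmooth v' → Torus.IsSmooth r' → Torus.IsDivFree v' → Torus.HasZeroMean v' →
        |∫ x, inner ℝ (ψ x) (Torus.convect w v' x + Torus.convect v' w x - ν • Torus.laplacian v' x +
            Torus.gradient r' x - c • Torus.partialDeriv (2 : Fin 3) v' x)| ≤
          ρ' * Real.sqrt (∫ x, ‖v' x‖ ^ 2)) →
      Real.sqrt (∫ x, ‖v x‖ ^ 2) ≤
          Real.sqrt (∫ x, ‖v x -
            ((∫ y, inner ℝ (v y) (Torus.partialDeriv (2 : Fin 3) w y)) /
              (∫ y, ‖Torus.partialDeriv (2 : Fin 3) w y‖ ^ 2)) • Torus.partialDeriv (2 : Fin 3) w x‖ ^ 2) +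
          |(∫ y, inner ℝ (v y) (Torus.partialDeriv (2 : Fin 3) w y)) /
              (∫ y, ‖Torus.partialDeriv (2 : Fin 3) w y‖ ^ 2)| *
            Real.sqrt (∫ x, ‖Torus.partialDeriv (2 : Fin 3) w x‖ ^ 2) ∧
        Real.sqrt (∫ x, ‖v x -
            ((∫ y, inner ℝ (v y) (Torus.partialDeriv (2 : Fin 3) w y)) /
              (∫ y, ‖Torus.partialDeriv (2 : Fin 3) w y‖ ^ 2)) • Torus.partialDeriv (2 : Fin 3) w x‖ ^ 2) ≤
          Λ * (Real.sqrt (∫ x, ‖Torus.convect w v x + Torus.convect v w x - ν • Torus.laplacian v x +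
              Torus.gradient r x - c • Torus.partialDeriv (2 : Fin 3) v x -
              b • Torus.partialDeriv (2 : Fin 3) w x‖ ^ 2) +
            |b| * Real.sqrt (∫ x, ‖Torus.partialDeriv (2 : Fin 3) w x‖ ^ 2) +
            |(∫ y, inner ℝ (v y) (Torus.partialDeriv (2 : Fin 3) w y)) /
                (∫ y, ‖Torus.partialDeriv (2 : Fin 3) w y‖ ^ 2)| * ρ) ∧
        |b| * |∫ x, inner ℝ (ψ x) (Torus.partialDeriv (2 : Fin 3) w x)| ≤
          Real.sqrt (∫ x, ‖Torus.convect w v x + Torus.convect v w x - ν • Torus.laplacian v x +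
              Torus.gradient r x - c • Torus.partialDeriv (2 : Fin 3) v x -
              b • Torus.partialDeriv (2 : Fin 3) w x‖ ^ 2) +
            ρ' * Real.sqrt (∫ x, ‖v x‖ ^ 2) :=
  Summit.AnomalousDissipation.AnomalousDissipation.Theorems.stub_kellerAnalysis

/-- STUB 1c — KELLER BORDERING, ALGEBRAIC HALF (LANDED p160297,
`Theorems.NeutralTaylorWavesNonresonantSelectionKellerAlgebra`). With `V = ‖v‖₂`, `U = ‖u‖₂`,
`Φ = ‖∂₃w‖₂`, `Fn = ‖F‖₂`, `Bd = ⟨v, ∂₃w⟩` (the border), `Pr = |⟨ψ, ∂₃w⟩|` (the pairing), one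
largeness parameter `Λ ≥ 1` (`Φ ≤ Λ`, `Φ⁻¹ ≤ Λ`, `Pr⁻¹ ≤ Λ`, reduced bound `Λ`) and smallness
`ρΛ³ ≤ 1`, `2ρ′Λ³ ≤ 1`: the three inequalities of stub 1b give `V ≤ 4Λ³(Fn + |Bd|)`,
`|b| ≤ 3Λ³(Fn + |Bd|)`, hence `V² + b² ≤ (10Λ³)²(Fn² + Bd²)`. -/
theorem stub_kellerAlgebra :
    ∀ (Λ ρ ρ' V U Φ Fn b Bd Pr : ℝ),
      1 ≤ Λ → 0 ≤ ρ → 0 ≤ ρ' → ρ * Λ ^ 3 ≤ 1 → 2 * ρ' * Λ ^ 3 ≤ 1 →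
      0 ≤ V → 0 ≤ U → 0 ≤ Fn → 0 < Φ → Φ ≤ Λ → 1 ≤ Λ * Φ → 1 ≤ Λ * Pr →
      V ≤ U + |Bd / Φ ^ 2| * Φ →
      U ≤ Λ * (Fn + |b| * Φ + |Bd / Φ ^ 2| * ρ) →
      |b| * Pr ≤ Fn + ρ' * V →
      V ^ 2 + b ^ 2 ≤ (10 * Λ ^ 3) ^ 2 * (Fn ^ 2 + Bd ^ 2) :=
  Summit.AnomalousDissipation.AnomalousDissipation.Theorems.stub_kellerAlgebra

/-- STUB 2a — ENERGY INEQUALITY OF THE BORDERED LINEARISED STEADY OPERATOR (LANDED p158645,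
`Theorems.NeutralTaylorWavesNonresonantSelectionLinearisedEnergyIneq`). At a smooth divergence-free base `w` with `sup ‖∂ᵢw‖ ≤ G`, for smooth divergence-free `v`, smooth `r`,
reals `ν, c, b`: with `F = w·∇v + v·∇w − νΔv + ∇r − c∂₃v − b∂₃w`, the energy identity
`∫⟪F, v⟫ = ∫⟪v·∇w, v⟫ + ν‖∇v‖₂² − b∫⟪∂₃w, v⟫` (`∫⟪w·∇v,v⟫ = ∫⟪∇r,v⟫ = ∫⟪∂₃v,v⟫ = 0`,
`∫⟪Δv,v⟫ = −‖∇v‖₂²`) and `|∫⟪v·∇w, v⟫| ≤ 3G∫‖v‖²` give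
`ν‖∇v‖₂² ≤ ‖F‖₂‖v‖₂ + 3G‖v‖₂² + |b|·|∫⟪v, ∂₃w⟫|`. -/
theorem stub_linearisedEnergyIneq :
    ∀ (ν c b G : ℝ) (w v : UnitAddTorus (Fin 3) → EuclideanSpace ℝ (Fin 3)) (r : UnitAddTorus (Fin 3) → ℝ),
      Torus.IsSmooth w → Torus.IsDivFree w → Torus.IsSmooth v → Torus.IsDivFree v → Torus.IsSmooth r →
      (∀ (i : Fin 3) x, ‖Torus.partialDeriv i w x‖ ≤ G) →
      ν * Torus.gradNormSq v ≤
        Real.sqrt (∫ x, ‖Torus.convect w v x + Torus.convect v w x - ν • Torus.laplacian v x +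
            Torus.gradient r x - c • Torus.partialDeriv (2 : Fin 3) v x -
            b • Torus.partialDeriv (2 : Fin 3) w x‖ ^ 2) * Real.sqrt (∫ x, ‖v x‖ ^ 2) +
        3 * G * (∫ x, ‖v x‖ ^ 2) +
        |b| * |∫ x, inner ℝ (v x) (Torus.partialDeriv (2 : Fin 3) w x)| :=
  Summit.AnomalousDissipation.AnomalousDissipation.Theorems.stub_linearisedEnergyIneq

/-- STUB 2b — PERTURBATION OF THE BORDERED RESIDUAL (LANDED p159030,
`Theorems.NeutralTaylorWavesNonresonantSelectionResidualPerturbation`). For smooth `w₁, w, v`, smooth `r`, reals `ν, c₁, c, b` and `δ ≥ 0` with `sup‖w − w₁‖ ≤ δ`,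
`sup‖∂ᵢw − ∂ᵢw₁‖ ≤ δ`, `|c − c₁| ≤ δ`: the bordered residuals `F₁` (at `(w₁, c₁)`) and `F` (at `(w, c)`)
of the same test triple `(v, r, b)` satisfy `‖F₁‖₂ ≤ ‖F‖₂ + δ(2‖∇v‖₂ + 2‖v‖₂ + |b|)` and the border
pairings `|∫⟪v, ∂₃w₁⟫ − ∫⟪v, ∂₃w⟫| ≤ δ‖v‖₂` (`F₁ − F = (w₁−w)·∇v + v·∇(w₁−w) − (c₁−c)∂₃v − b∂₃(w₁−w)`,
`‖Dv(x)e‖ ≤ ‖e‖(∑ᵢ‖∂ᵢv(x)‖²)^{1/2}`, `‖∑ᵢ vᵢ eᵢ‖ ≤ √3‖v‖ sup‖eᵢ‖`, Cauchy–Schwarz). -/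
theorem stub_residualPerturbation :
    ∀ (ν c₁ c b δ : ℝ) (w₁ w v : UnitAddTorus (Fin 3) → EuclideanSpace ℝ (Fin 3))
      (r : UnitAddTorus (Fin 3) → ℝ),
      Torus.IsSmooth w₁ → Torus.IsSmooth w → Torus.IsSmooth v → Torus.IsSmooth r → 0 ≤ δ →
      (∀ x, ‖w x - w₁ x‖ ≤ δ) →
      (∀ (i : Fin 3) x, ‖Torus.partialDeriv i w x - Torus.partialDeriv i w₁ x‖ ≤ δ) →
      |c - c₁| ≤ δ →
      Real.sqrt (∫ x, ‖Torus.convect w₁ v x + Torus.convect v w₁ x - ν • Torus.laplacian v x +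
            Torus.gradient r x - c₁ • Torus.partialDeriv (2 : Fin 3) v x -
            b • Torus.partialDeriv (2 : Fin 3) w₁ x‖ ^ 2) ≤
          Real.sqrt (∫ x, ‖Torus.convect w v x + Torus.convect v w x - ν • Torus.laplacian v x +
            Torus.gradient r x - c • Torus.partialDeriv (2 : Fin 3) v x -
            b • Torus.partialDeriv (2 : Fin 3) w x‖ ^ 2) +
          δ * (2 * Real.sqrt (Torus.gradNormSq v) + 2 * Real.sqrt (∫ x, ‖v x‖ ^ 2) + |b|) ∧
        |(∫ x, inner ℝ (v x) (Torus.partialDeriv (2 : Fin 3) w₁ x)) -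
            ∫ x, inner ℝ (v x) (Torus.partialDeriv (2 : Fin 3) w x)| ≤
          δ * Real.sqrt (∫ x, ‖v x‖ ^ 2) :=
  Summit.AnomalousDissipation.AnomalousDissipation.Theorems.stub_residualPerturbation

/-- STUB 2c — THE TRANSFER ALGEBRA (LANDED p158885,
`Theorems.NeutralTaylorWavesNonresonantSelectionTransferAlgebra`; `κ = 1/16`, `A = 2`). With
`X² = E + b²`, `Y² = P + g²`, `Y₁² = P₁ + g₁²`: the spine bound `X ≤ M Y₁`, the energy inequality
`νD ≤ √P√E + 3GE + |b||g|` (so `√D ≤ ν^{-1/2}(Y + (1+2G)X)`), the perturbation bounds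
`√P₁ ≤ √P + δ(2√D + 2√E + |b|)`, `|g₁ − g| ≤ δ√E` and the smallness `δ(1+M)(1+G) ≤ ν/16`, `ν ≤ 1`
give `X ≤ (M + 1/8)Y + X/2`, hence `X² ≤ (2(1+M))² Y²`. -/
theorem stub_transferAlgebra :
    ∀ (ν M G δ E b P g P₁ g₁ D : ℝ),
      0 < ν → ν ≤ 1 → 0 ≤ M → 0 ≤ G → 0 ≤ δ → 0 ≤ E → 0 ≤ P → 0 ≤ P₁ → 0 ≤ D →
      δ * (1 + M) * (1 + G) ≤ ν / 16 →
      E + b ^ 2 ≤ M ^ 2 * (P₁ + g₁ ^ 2) →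
      ν * D ≤ Real.sqrt P * Real.sqrt E + 3 * G * E + |b| * |g| →
      Real.sqrt P₁ ≤ Real.sqrt P + δ * (2 * Real.sqrt D + 2 * Real.sqrt E + |b|) →
      |g₁ - g| ≤ δ * Real.sqrt E →
      E + b ^ 2 ≤ (2 * (1 + M)) ^ 2 * (P + g ^ 2) :=
  Summit.AnomalousDissipation.AnomalousDissipation.Theorems.stub_transferAlgebra

/-! ### Composition of the approximate Keller bordering lemma from stubs 1b–1c -/

/-- **Approximate Keller bordering lemma on `T³`** (from stubs 1b, 1c BY NAME). At a smooth
divergence-free base `(w, c)`, viscosity `ν`: if, for one largeness parameter `Λ ≥ 1`,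
`Λ⁻¹ ≤ ‖∂₃w‖₂ ≤ Λ`, a smooth `ψ` with `‖ψ‖₂ ≤ 1` pairs with the phase direction, `Λ|⟨ψ, ∂₃w⟩| ≥ 1`,
the unbordered operator `A(v, r) = w·∇v + v·∇w − νΔv + ∇r − c∂₃v` has the reduced bound
`‖u‖₂ ≤ Λ‖A(u, r)‖₂` on test fields `u ⊥ ∂₃w`, `∂₃w` is an approximate kernel vector
(`‖A(∂₃w, q₃)‖₂ ≤ ρ`, `ρΛ³ ≤ 1`) and `ψ` an approximate cokernel vector (`|⟨ψ, A(v, r)⟩| ≤ ρ′‖v‖₂`,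
`2ρ′Λ³ ≤ 1`), then the BORDERED a-priori bound holds with constant `10Λ³`. -/
theorem approxKellerBordering :
    ∀ (ν c Λ ρ ρ' : ℝ) (w ψ : UnitAddTorus (Fin 3) → EuclideanSpace ℝ (Fin 3))
      (q₃ : UnitAddTorus (Fin 3) → ℝ),
      1 ≤ Λ → 0 ≤ ρ → 0 ≤ ρ' → ρ * Λ ^ 3 ≤ 1 → 2 * ρ' * Λ ^ 3 ≤ 1 →
      Torus.IsSmooth w → Torus.IsDivFree w → Torus.IsSmooth ψ → Torus.IsSmooth q₃ →
      (∫ x, ‖ψ x‖ ^ 2) ≤ 1 →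
      Real.sqrt (∫ x, ‖Torus.partialDeriv (2 : Fin 3) w x‖ ^ 2) ≤ Λ →
      1 ≤ Λ * Real.sqrt (∫ x, ‖Torus.partialDeriv (2 : Fin 3) w x‖ ^ 2) →
      1 ≤ Λ * |∫ x, inner ℝ (ψ x) (Torus.partialDeriv (2 : Fin 3) w x)| →
      Real.sqrt (∫ x, ‖Torus.convect w (Torus.partialDeriv (2 : Fin 3) w) x +
          Torus.convect (Torus.partialDeriv (2 : Fin 3) w) w x -
          ν • Torus.laplacian (Torus.partialDeriv (2 : Fin 3) w) x + Torus.gradient q₃ x -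
          c • Torus.partialDeriv (2 : Fin 3) (Torus.partialDeriv (2 : Fin 3) w) x‖ ^ 2) ≤ ρ →
      (∀ (v' : UnitAddTorus (Fin 3) → EuclideanSpace ℝ (Fin 3)) (r' : UnitAddTorus (Fin 3) → ℝ),
        Torus.IsSmooth v' → Torus.IsSmooth r' → Torus.IsDivFree v' → Torus.HasZeroMean v' →
        |∫ x, inner ℝ (ψ x) (Torus.convect w v' x + Torus.convect v' w x - ν • Torus.laplacian v' x +
            Torus.gradient r' x - c • Torus.partialDeriv (2 : Fin 3) v' x)| ≤
          ρ' * Real.sqrt (∫ x, ‖v' x‖ ^ 2)) →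
      (∀ (u : UnitAddTorus (Fin 3) → EuclideanSpace ℝ (Fin 3)) (r' : UnitAddTorus (Fin 3) → ℝ),
        Torus.IsSmooth u → Torus.IsSmooth r' → Torus.IsDivFree u → Torus.HasZeroMean u →
        (∫ x, inner ℝ (u x) (Torus.partialDeriv (2 : Fin 3) w x)) = 0 →
        Real.sqrt (∫ x, ‖u x‖ ^ 2) ≤
          Λ * Real.sqrt (∫ x, ‖Torus.convect w u x + Torus.convect u w x - ν • Torus.laplacian u x +
            Torus.gradient r' x - c • Torus.partialDeriv (2 : Fin 3) u x‖ ^ 2)) →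
      BorderedBound ν w c (10 * Λ ^ 3) := by
  intro ν c Λ ρ ρ' w ψ q₃ hΛ hρ hρ' hρΛ hρ'Λ hw hwdiv hψ hq₃ hψ1 hΦle hΦge hpair hker hcoker hgap v r b
    hv hr hvdiv hvmean
  -- names for the real quantities
  set I : ℝ := ∫ x, ‖Torus.partialDeriv (2 : Fin 3) w x‖ ^ 2 with hI_def
  set Φ : ℝ := Real.sqrt I with hΦ_def
  set Bd : ℝ := ∫ x, inner ℝ (v x) (Torus.partialDeriv (2 : Fin 3) w x) with hBd_def
  set V : ℝ := Real.sqrt (∫ x, ‖v x‖ ^ 2) with hV_def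
  set U : ℝ := Real.sqrt (∫ x, ‖v x - (Bd / I) • Torus.partialDeriv (2 : Fin 3) w x‖ ^ 2) with hU_def
  set Fn : ℝ := Real.sqrt (∫ x, ‖Torus.convect w v x + Torus.convect v w x - ν • Torus.laplacian v x +
      Torus.gradient r x - c • Torus.partialDeriv (2 : Fin 3) v x -
      b • Torus.partialDeriv (2 : Fin 3) w x‖ ^ 2) with hFn_def
  set Pr : ℝ := |∫ x, inner ℝ (ψ x) (Torus.partialDeriv (2 : Fin 3) w x)| with hPr_def
  have hΛ0 : 0 ≤ Λ := zero_le_one.trans hΛ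
  have hI0 : 0 ≤ I := integral_nonneg fun x => by positivity
  have hΦpos : 0 < Φ := by
    rcases (Real.sqrt_nonneg I).eq_or_lt with h | h
    · exfalso
      have : (1 : ℝ) ≤ 0 := by simpa [hΦ_def, ← h] using hΦge
      linarith
    · exact h
  have hIpos : 0 < I := by
    by_contra h
    have hI : I = 0 := le_antisymm (not_lt.1 h) hI0
    have : Φ = 0 := by rw [hΦ_def, hI, Real.sqrt_zero]
    linarith
  have hΦ2 : Φ ^ 2 = I := Real.sq_sqrt hI0
  -- the analytic half
  obtain ⟨h1, h2, h3⟩ := stub_kellerAnalysis ν c b Λ ρ ρ' w ψ v q₃ r hΛ0 hw hwdiv hψ hq₃ hv hvdiv hvmean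
    hr hIpos hψ1 hgap hker hcoker
  -- the algebraic half
  have hV0 : 0 ≤ V := Real.sqrt_nonneg _
  have hU0 : 0 ≤ U := Real.sqrt_nonneg _
  have hFn0 : 0 ≤ Fn := Real.sqrt_nonneg _
  have h1' : V ≤ U + |Bd / Φ ^ 2| * Φ := by rw [hΦ2]; exact h1
  have h2' : U ≤ Λ * (Fn + |b| * Φ + |Bd / Φ ^ 2| * ρ) := by rw [hΦ2]; exact h2
  have key := stub_kellerAlgebra Λ ρ ρ' V U Φ Fn b Bd Pr hΛ hρ hρ' hρΛ hρ'Λ hV0 hU0 hFn0 hΦpos hΦle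
    hΦge hpair h1' h2' h3
  have hV2 : V ^ 2 = ∫ x, ‖v x‖ ^ 2 := Real.sq_sqrt (integral_nonneg fun x => by positivity)
  have hFn2 : Fn ^ 2 = ∫ x, ‖Torus.convect w v x + Torus.convect v w x - ν • Torus.laplacian v x +
      Torus.gradient r x - c • Torus.partialDeriv (2 : Fin 3) v x -
      b • Torus.partialDeriv (2 : Fin 3) w x‖ ^ 2 := Real.sq_sqrt (integral_nonneg fun x => by positivity)
  rw [hV2, hFn2] at key
  exact key

/-- **The registrar's stub 1 (`stub_coherentSpineGap`) from the spectral core and the Keller bordering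
lemma** (stubs 1′, 1b, 1c BY NAME): with `Λ_n = C₀ν_n^{-K₀}`, `ρ = Λ_n⁻³`, `ρ′ = Λ_n⁻³/2` the Keller
data of the core give the bordered bound at the spine with constant `10Λ_n³ = (10C₀³) ν_n^{-3K₀}` along
the core's subsequence; the coherent family is passed through with `K₀′ = 3K₀`, `K₀′ + 3 ≤ a`. -/
theorem coherentSpineGap_of_core :
    TaylorWaveQuasiSteady →
    ∃ f : UnitAddTorus (Fin 3) → EuclideanSpace ℝ (Fin 3),
      Torus.IsSmooth f ∧ Torus.IsDivFree f ∧ Torus.HasZeroMean f ∧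
    ∃ (ν : ℕ → ℝ) (E ε₀ C₀ : ℝ) (K₀ a : ℕ)
      (w₁ : ℕ → UnitAddTorus (Fin 3) → EuclideanSpace ℝ (Fin 3)) (c₁ : ℕ → ℝ),
      (∀ n, 0 < ν n) ∧ Tendsto ν atTop (𝓝 0) ∧ 0 < ε₀ ∧ K₀ + 3 ≤ a ∧
      (∀ n, Torus.IsSmooth (w₁ n) ∧ Torus.IsDivFree (w₁ n)) ∧
      (∀ N : ℕ, ∃ n : ℕ, N ≤ n ∧ BorderedBound (ν n) (w₁ n) (c₁ n) (C₀ * (ν n)⁻¹ ^ K₀)) ∧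
      ∀ K : ℕ, ∃ C : ℝ, ∀ n : ℕ,
        ∃ (w : UnitAddTorus (Fin 3) → EuclideanSpace ℝ (Fin 3)) (q : UnitAddTorus (Fin 3) → ℝ) (c : ℝ),
          Torus.IsSmooth w ∧ Torus.IsSmooth q ∧ Torus.IsDivFree w ∧ Torus.HasZeroMean w ∧ |c| ≤ C ∧
          (∫ x, ‖w x‖ ^ 2) ≤ E ∧
          |ν n * Torus.gradNormSq w - ε₀| ≤ C * Real.sqrt (ν n) ∧
          (∫ x, ‖Torus.convect w w x - (ν n) • Torus.laplacian w x + Torus.gradient q x -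
              c • Torus.partialDeriv (2 : Fin 3) w x - f x‖ ^ 2) ≤ C * (ν n) ^ K ∧
          (∀ x, ‖w x‖ ≤ C) ∧ (∀ (i : Fin 3) x, ‖Torus.partialDeriv i w x‖ ≤ C * (ν n)⁻¹) ∧
          (∀ (i j : Fin 3) x, ‖Torus.partialDeriv i (Torus.partialDeriv j w) x‖ ≤ C * (ν n)⁻¹ ^ 2) ∧
          (∀ x, ‖w x - w₁ n x‖ ≤ C * (ν n) ^ a) ∧
          (∀ (i : Fin 3) x, ‖Torus.partialDeriv i w x - Torus.partialDeriv i (w₁ n) x‖ ≤ C * (ν n) ^ a) ∧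
          |c - c₁ n| ≤ C * (ν n) ^ a := by
  intro hTW
  obtain ⟨f, hf, hfdiv, hfmean, ν, E, ε₀, C₀, K₀, a, w₁, c₁, hνpos, hνlim, hε₀, hC₀, ha, hw₁, hcore,
    hfam⟩ := stub_spineCore hTW
  refine ⟨f, hf, hfdiv, hfmean, ν, E, ε₀, 10 * C₀ ^ 3, 3 * K₀, a, w₁, c₁, hνpos, hνlim, hε₀, ha, hw₁,
    ?_, hfam⟩
  intro N
  obtain ⟨n, hn, hν1, ψ, q₃, hψ, hq₃, hψ1, hΦle, hΦge, hpair, hker, hcoker, hgap⟩ := hcore N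
  refine ⟨n, hn, ?_⟩
  set x : ℝ := ν n with hx_def
  have hx0 : 0 < x := hνpos n
  set Λ : ℝ := C₀ * x⁻¹ ^ K₀ with hΛ_def
  have hy1 : 1 ≤ x⁻¹ ^ K₀ := one_le_pow₀ ((one_le_inv₀ hx0).2 hν1)
  have hΛ1 : 1 ≤ Λ := by
    have := mul_le_mul hC₀ hy1 zero_le_one (zero_le_one.trans hC₀)
    simpa [hΛ_def] using this
  have hΛ0 : 0 < Λ := one_pos.trans_le hΛ1
  have hΛ3 : Λ⁻¹ ^ 3 * Λ ^ 3 = 1 := by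
    rw [inv_pow, inv_mul_cancel₀ (pow_ne_zero _ hΛ0.ne')]
  have key : BorderedBound x (w₁ n) (c₁ n) (10 * Λ ^ 3) :=
    approxKellerBordering x (c₁ n) Λ (Λ⁻¹ ^ 3) (Λ⁻¹ ^ 3 / 2) (w₁ n) ψ q₃ hΛ1 (by positivity)
      (by positivity) hΛ3.le (by rw [show 2 * (Λ⁻¹ ^ 3 / 2) * Λ ^ 3 = Λ⁻¹ ^ 3 * Λ ^ 3 by ring, hΛ3])
      (hw₁ n).1 (hw₁ n).2 hψ hq₃ hψ1 hΦle hΦge hpair hker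
      (fun v' r' hv' hr' hv'div hv'mean => by
        have h := hcoker v' r' hv' hr' hv'div hv'mean
        have h0 : 0 ≤ Real.sqrt (∫ x, ‖v' x‖ ^ 2) := Real.sqrt_nonneg _
        nlinarith [h, h0])
      hgap
  have e : 10 * Λ ^ 3 = 10 * C₀ ^ 3 * x⁻¹ ^ (3 * K₀) := by
    rw [hΛ_def, mul_pow, ← pow_mul, mul_comm K₀ 3]; ring
  rw [e] at key
  exact key

/-! ### Composition of the Kato-type stability from stubs 2a–2c -/

/-- **Perturbative stability of polynomial bordered bounds** (the registrar's `stub_borderedGapStability`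
with `κ = 1/16`, `A = 2`), from stubs 2a, 2b, 2c BY NAME: if the bordered bound holds at `(w₁, c₁)` with
constant `M`, `sup‖∂ᵢw‖ ≤ G`, `(w, c)` is `δ`-close to `(w₁, c₁)` in `W^{1,∞} × drift` and
`δ(1+M)(1+G) ≤ ν/16`, `0 < ν ≤ 1`, then the bordered bound holds at `(w, c)` with constant `2(1+M)`. -/
theorem borderedGapStability :
    ∀ (ν : ℝ) (w₁ w : UnitAddTorus (Fin 3) → EuclideanSpace ℝ (Fin 3)) (c₁ c M G δ : ℝ),
      0 < ν → ν ≤ 1 → 0 ≤ M → 0 ≤ G → 0 ≤ δ →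
      Torus.IsSmooth w₁ → Torus.IsDivFree w₁ → Torus.IsSmooth w → Torus.IsDivFree w →
      BorderedBound ν w₁ c₁ M →
      (∀ (i : Fin 3) x, ‖Torus.partialDeriv i w x‖ ≤ G) →
      (∀ x, ‖w x - w₁ x‖ ≤ δ) →
      (∀ (i : Fin 3) x, ‖Torus.partialDeriv i w x - Torus.partialDeriv i w₁ x‖ ≤ δ) →
      |c - c₁| ≤ δ →
      δ * (1 + M) * (1 + G) ≤ ν / 16 →
      BorderedBound ν w c (2 * (1 + M)) := by
  intro ν w₁ w c₁ c M G δ hν hν1 hM hG hδ hw₁ _hw₁div hw hwdiv hgap hsupG hprox0 hprox1 hproxc hsmall v r b hv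
    hr hvdiv hvmean
  -- the six real quantities of the test triple
  set E : ℝ := ∫ x, ‖v x‖ ^ 2 with hE_def
  set P : ℝ := ∫ x, ‖Torus.convect w v x + Torus.convect v w x - ν • Torus.laplacian v x +
      Torus.gradient r x - c • Torus.partialDeriv (2 : Fin 3) v x -
      b • Torus.partialDeriv (2 : Fin 3) w x‖ ^ 2 with hP_def
  set g : ℝ := ∫ x, inner ℝ (v x) (Torus.partialDeriv (2 : Fin 3) w x) with hg_def
  set P₁ : ℝ := ∫ x, ‖Torus.convect w₁ v x + Torus.convect v w₁ x - ν • Torus.laplacian v x +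
      Torus.gradient r x - c₁ • Torus.partialDeriv (2 : Fin 3) v x -
      b • Torus.partialDeriv (2 : Fin 3) w₁ x‖ ^ 2 with hP₁_def
  set g₁ : ℝ := ∫ x, inner ℝ (v x) (Torus.partialDeriv (2 : Fin 3) w₁ x) with hg₁_def
  set D : ℝ := Torus.gradNormSq v with hD_def
  have hE0 : 0 ≤ E := integral_nonneg fun x => by positivity
  have hP0 : 0 ≤ P := integral_nonneg fun x => by positivity
  have hP₁0 : 0 ≤ P₁ := integral_nonneg fun x => by positivity
  have hD0 : 0 ≤ D := Torus.gradNormSq_nonneg v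
  -- (h1) the bound at the spine, (h2) energy, (h3)/(h4) perturbation
  have h1 : E + b ^ 2 ≤ M ^ 2 * (P₁ + g₁ ^ 2) := hgap v r b hv hr hvdiv hvmean
  have h2 : ν * D ≤ Real.sqrt P * Real.sqrt E + 3 * G * E + |b| * |g| :=
    stub_linearisedEnergyIneq ν c b G w v r hw hwdiv hv hvdiv hr hsupG
  obtain ⟨h3, h4⟩ :=
    stub_residualPerturbation ν c₁ c b δ w₁ w v r hw₁ hw hv hr hδ hprox0 hprox1 hproxc
  exact stub_transferAlgebra ν M G δ E b P g P₁ g₁ D hν hν1 hM hG hδ hE0 hP0 hP₁0 hD0 hsmall h1 h2 h3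
    h4

/-! ### Composition: the crux from the registered stubs -/

/-- **The line closes the crux BY NAME modulo the registered stubs** (no `sorry` of its own; depends on
`sorryAx` only through the stubs): uniformity in the order `K` is automatic — given `K` and `N`, pick
`n ≥ N` in the spine's gap set so late that `ν_n ≤ 1` and `16 D ν_n ≤ 1`, `D := C_K(1+|C₀|)(1+C_K)`; with
`x = ν_n`, `δ = C_K x^a`, `M = |C₀| x^{-K₀}`, `G = C_K x⁻¹` the smallness `δ(1+M)(1+G) ≤ D x² ≤ x/16`
holds (`x^a ≤ x^{K₀+3}`), the Kato-type stability `borderedGapStability` (stubs 2a–2c) transfers the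
bound from the spine (stub 1) to the order-`K` state with constant `2(1 + |C₀|x^{-K₀}) ≤ 2(1+|C₀|) x^{-K₀}`,
which is the target's last clause verbatim. -/
theorem NonresonantSelection_proof : NonresonantSelection := by
  have hstab := borderedGapStability
  intro hTW
  obtain ⟨f, hf, hfdiv, hfmean, ν, E, ε₀, C₀, K₀, a, w₁, c₁, hνpos, hνlim, hε₀, ha, hw₁, hgap, hfam⟩ :=
    coherentSpineGap_of_core hTW
  refine ⟨f, hf, hfdiv, hfmean, ν, E, ε₀, 2 * (1 + |C₀|), K₀, hνpos, hνlim, hε₀, ?_⟩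
  intro K
  obtain ⟨C, hC⟩ := hfam K
  refine ⟨C, ?_⟩
  intro N
  -- the smallness threshold: `ν n ≤ 1` and `16 D ν n ≤ 1`, `D := C (1 + |C₀|) (1 + C)`
  set D : ℝ := C * (1 + |C₀|) * (1 + C) with hD
  have hνs : 0 < min 1 (1 / (16 * (|D| + 1))) := lt_min one_pos (by positivity)
  obtain ⟨N₁, hN₁⟩ := eventually_atTop.1 (hνlim.eventually_lt_const hνs)
  obtain ⟨n, hn, hgapn⟩ := hgap (max N N₁)
  obtain ⟨w, q, c, hw, hq, hwdiv, hwmean, hc, hE, hdiss, hres, hsup0, hsup1, hsup2, hprox0, hprox1,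
    hproxc⟩ := hC n
  refine ⟨n, (le_max_left _ _).trans hn, w, q, c, hw, hq, hwdiv, hwmean, hc, hE, hdiss, hres, hsup0,
    hsup1, hsup2, ?_⟩
  -- abbreviations and signs
  have hlt : ν n < min 1 (1 / (16 * (|D| + 1))) := hN₁ n ((le_max_right _ _).trans hn)
  set x : ℝ := ν n with hx_def
  have hx0 : 0 < x := hνpos n
  have hx : x ≠ 0 := hx0.ne'
  have hx1 : x ≤ 1 := (hlt.trans_le (min_le_left _ _)).le
  have hxκ : D * x ≤ 1 / 16 := by
    have h1 : x < 1 / (16 * (|D| + 1)) := hlt.trans_le (min_le_right _ _)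
    have h2 : x * (16 * (|D| + 1)) < 1 := (lt_div_iff₀ (by positivity)).1 h1
    have h3 : D * x ≤ |D| * x := mul_le_mul_of_nonneg_right (le_abs_self D) hx0.le
    nlinarith
  have hC0 : 0 ≤ C := (norm_nonneg _).trans (hsup0 0)
  have hy1 : 1 ≤ x⁻¹ ^ K₀ := one_le_pow₀ ((one_le_inv₀ hx0).2 hx1)
  -- the gap at the spine with the nonnegative constant `|C₀| x⁻¹^K₀`
  have hgap0 : BorderedBound x (w₁ n) (c₁ n) (C₀ * x⁻¹ ^ K₀) := hgapn
  have hgap' : BorderedBound x (w₁ n) (c₁ n) (|C₀| * x⁻¹ ^ K₀) :=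
    hgap0.mono (le_of_eq (by rw [mul_pow, mul_pow, sq_abs]))
  -- the smallness condition `δ (1 + M) (1 + G) ≤ x / 16`
  have hsmall : C * x ^ a * (1 + |C₀| * x⁻¹ ^ K₀) * (1 + C * x⁻¹) ≤ x / 16 := by
    have h1 : x ^ a ≤ x ^ (K₀ + 3) := pow_le_pow_of_le_one hx0.le hx1 ha
    have e1 : x ^ (K₀ + 3) * x⁻¹ ^ K₀ = x ^ 3 := by
      rw [inv_pow, pow_add, mul_assoc, mul_comm (x ^ 3), ← mul_assoc,
        mul_inv_cancel₀ (pow_ne_zero _ hx), one_mul]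
    have h2 : x ^ (K₀ + 3) * (1 + |C₀| * x⁻¹ ^ K₀) ≤ (1 + |C₀|) * x ^ 3 := by
      have e : x ^ (K₀ + 3) * (1 + |C₀| * x⁻¹ ^ K₀) = x ^ (K₀ + 3) + |C₀| * x ^ 3 := by
        rw [← e1]; ring
      have h : x ^ (K₀ + 3) ≤ x ^ 3 := pow_le_pow_of_le_one hx0.le hx1 (by omega)
      rw [e]
      nlinarith [abs_nonneg C₀, pow_pos hx0 3]
    have e2 : x ^ 3 * x⁻¹ = x ^ 2 := by field_simp
    have h3 : x ^ 3 * (1 + C * x⁻¹) ≤ (1 + C) * x ^ 2 := by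
      have e : x ^ 3 * (1 + C * x⁻¹) = x ^ 3 + C * x ^ 2 := by rw [← e2]; ring
      have h : x ^ 3 ≤ x ^ 2 := pow_le_pow_of_le_one hx0.le hx1 (by norm_num)
      rw [e]
      nlinarith [pow_pos hx0 2]
    have hG0 : 0 ≤ 1 + C * x⁻¹ := by positivity
    have hM0 : 0 ≤ 1 + |C₀| * x⁻¹ ^ K₀ := by positivity
    calc C * x ^ a * (1 + |C₀| * x⁻¹ ^ K₀) * (1 + C * x⁻¹)
        ≤ C * x ^ (K₀ + 3) * (1 + |C₀| * x⁻¹ ^ K₀) * (1 + C * x⁻¹) := by gcongr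
      _ = C * (x ^ (K₀ + 3) * (1 + |C₀| * x⁻¹ ^ K₀)) * (1 + C * x⁻¹) := by ring
      _ ≤ C * ((1 + |C₀|) * x ^ 3) * (1 + C * x⁻¹) := by gcongr
      _ = C * (1 + |C₀|) * (x ^ 3 * (1 + C * x⁻¹)) := by ring
      _ ≤ C * (1 + |C₀|) * ((1 + C) * x ^ 2) := by gcongr
      _ = (D * x) * x := by rw [hD]; ring
      _ ≤ (1 / 16) * x := mul_le_mul_of_nonneg_right hxκ hx0.le
      _ = x / 16 := by ring
  -- transfer the bound from the spine to the order-`K` state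
  have key : BorderedBound x w c (2 * (1 + |C₀| * x⁻¹ ^ K₀)) :=
    hstab x (w₁ n) w (c₁ n) c (|C₀| * x⁻¹ ^ K₀) (C * x⁻¹) (C * x ^ a) hx0 hx1 (by positivity)
      (by positivity) (by positivity) (hw₁ n).1 (hw₁ n).2 hw hwdiv hgap' hsup1 hprox0 hprox1 hproxc
      hsmall
  -- and enlarge the constant to `2 (1 + |C₀|) x⁻¹^K₀`
  have hle : 2 * (1 + |C₀| * x⁻¹ ^ K₀) ≤ 2 * (1 + |C₀|) * x⁻¹ ^ K₀ := by
    have h := mul_le_mul_of_nonneg_left hy1 (abs_nonneg C₀)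
    nlinarith [hy1, abs_nonneg C₀]
  exact key.mono (pow_le_pow_left₀ (by positivity) hle 2)

end Summit.AnomalousDissipation.AnomalousDissipation.Cruxes.NonresonantSelection.Birth

end
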